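import Literature.NumberTheory.Automorphic.UnitaryGroupCohomologicalForms
import Summits.HodgeConjecture.HodgeConjecture.Theorems.F0P2aCmFrameFactorisation
import HarnessLib

/-!
# FLOOR-0 P2, (D)-desk sub-line `F0_P2SpectralProjectionD` — brick (h4) for STUB (R): GLOBAL CONTINUITY on `U(H)(𝔸_{L⁺})`
# from continuity along the `U(2,1)`-orbits plus right `K_c`- and `K_f`-invariance (the product structure of the CM frame)

Cell hodgecm-mathlib, FLOOR 0, crux item H413 = stmt-HodgeConjecture-24833 (route `HCCMUnconditional`); sub-line
`Cruxes/H413/Lines/F0_P2SpectralProjectionD.lean` v1.1 (sha16 e1fa5bd1360092b6), stub (R) `stub_R_regularOfReproduced` (holder F0P2-p04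
(g2)); this file is the SEPARABLE brick «h4» of CENSUS-R §3 road (h) (F0P2-p01 (g2)) offered by F0P2-p02 (g2) (bus 00:17:04Z): the two
continuity fields `Realises.cont` and `Realises.contDeriv` of (R) ask for continuity ON THE WHOLE GROUP `U(H)(𝔸_{L⁺})` of the orbital
representative `Ψ` and of its probe derivatives, while the orbital-smoothing files (★ `AutomorphicFormsL2OrbitalSmoothing`,
`continuous_orbitalIntegral_mul_hom`) deliver continuity ALONG each `cmArchSection`-orbit `g ↦ Ψ (y · ιinf g)`.  The passage is purely
topological: PROOF lane, theorems only (no definition, no instance, no notation, no named fact, no `sorry`); imports ★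
`UnitaryGroupCohomologicalForms` + ★ `Theorems/F0P2aCmFrameFactorisation` (the CM product decomposition `x = ιinf(pr_ι x_∞) · k · (1, x_f)`,
F0P2a-p03/p05; its `continuous_of_mem_holCotForms_cm` sibling ★ `F0P2aCohFormsContinuous` is the same argument for SLICES OF HOLOMORPHIC forms —
here the orbit-continuity is an abstract hypothesis, as (R) needs it for orbital integrals of `L²` classes).

## Content ([BorelJacquet1979, §4.1]: `G(𝔸) = G_∞ × G(𝔸_f)`, `G_∞ = ιinf(U(2,1)) · K_c` for the CM frame)
* def-free spelling: the continuous «`U(2,1)`-coordinate» is the composite of ★ `archPart` (`g ↦ g_∞`) and ★ `archProjU21EmbCM`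
  (`U(H)(L⁺ ⊗ ℝ) →* U(2,1)` through the frame), written out; the decomposition `x = ιinf(pr_ι x_∞) · k · (1, x_f)`, `k ∈ cmCompactFactor`, is ★
  `F0P2aCmFrameFactorisation.exists_eq_cmArchSection_mul_cmCompactFactor_mul_finAdelicToAdelic`.
* **`apply_eq_apply_mul_cmArchSection`**: a right-`K_c`-invariant function `Ψ`, right-invariant under `(1, K_f)` for a subgroup `K_f` of
  the finite-adelic group, satisfies `Ψ x = Ψ (y · ιinf (pr ((y⁻¹ x)_∞)))` whenever `(y⁻¹ x)_f ∈ K_f`.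
* **`isOpen_of_invariant`**: a subset right-invariant under `ιinf(U(2,1))`, `K_c` and an open `(1, K_f)` is OPEN (the «bad set» of an
  orbital representative is such a set; open + `μ`-null on the quotient ⇒ empty).
* **`continuous_of_continuous_orbit_of_invariant`** (h4): if moreover `K_f` is OPEN and every orbit map `g ↦ Ψ (y · ιinf g)` is
  continuous on `U(2,1)`, then `Ψ` is continuous on `U(H)(𝔸_{L⁺})` (each point has the open neighbourhood `{x | (y⁻¹ x)_f ∈ K_f}` on which
  `Ψ` is the continuous composite above).  Valued in any topological space (used for `Ψ_j : … → ℂ` and for the probe derivatives).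

HC_CM is proved only modulo the printed citations until rung 0 closes; this file proves one topological brick and uses no printed
citation as a hypothesis.

## References
* [BorelJacquet1979] A. Borel, H. Jacquet, *Automorphic forms and automorphic representations*, PSPM 33.1 (1979), §4.1.
* [PlatonovRapinchuk1994] V. Platonov, A. Rapinchuk, *Algebraic groups and number theory* (1994), §5.1.
* Tree: ★ `UnitaryGroupAdelicProduct` (`archPart`, `finPart`, `continuous_finPart`, `continuous_archPart`, `archToAdelic_mul_finAdelicToAdelic`),
  ★ `UnitaryGroupArchProjectionEmb` (`archProjU21EmbCM`, `continuous_archProjU21EmbCM`), ★ `UnitaryGroupCohomologicalForms`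
  (`cmArchSection`, `cmCompactFactor`), ★ `Theorems/F0P2aCmFrameFactorisation` (`exists_eq_cmArchSection_mul_cmCompactFactor_mul_finAdelicToAdelic`).
-/

set_option autoImplicit false

-- the mandated namespace has the single-problem summit's repeated segment (`HodgeConjecture.HodgeConjecture`)
set_option linter.dupNamespace false

noncomputable section

namespace Summit.HodgeConjecture.HodgeConjecture.Cruxes.H413.F0P2dArchOrbitContinuity

open NumberField Topology
open scoped Matrix ComplexOrder
open Literature.NumberTheory.Automorphic Literature.NumberTheory.Automorphic.UnitaryGroup
open Literature.NumberTheory.Automorphic.UnitaryGroup.CotangentForms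
open Literature.AlgebraicGeometry.ShimuraVarieties
open Literature.Geometry.ComplexHyperbolic.BallModel (U21)
open Summit.HodgeConjecture.HodgeConjecture.Cruxes.H413.F0P2aCmFrameFactorisation

variable (L : Type) [Field L] [NumberField L] [IsCMField L] (ι : L →+* ℂ) (H : Matrix (Fin 3) (Fin 3) L) (T : GL (Fin 3) ℂ)
  (hT : (T : Matrix (Fin 3) (Fin 3) ℂ)ᴴ * H.map ι * (T : Matrix (Fin 3) (Fin 3) ℂ) = Literature.Geometry.ComplexHyperbolic.BallModel.J)

/-- **A right-`K_c`-invariant, right-`(1, K_f)`-invariant function is read off the `U(2,1)`-coordinate on each `K_f`-slab**: if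
`(y⁻¹ x)_f ∈ K_f` then `Ψ x = Ψ (y · ιinf (pr_ι ((y⁻¹ x)_∞)))`. [cite: BorelJacquet1979, §4.1] -/
theorem apply_eq_apply_mul_cmArchSection {X : Type*}
    {Ψ : (adelicGroupData (↥(maximalRealSubfield L)) L (IsCMField.complexConj L) 3 H).Adelic → X}
    (hkc : ∀ k ∈ cmCompactFactor L ι H T hT, ∀ x, Ψ (x * k) = Ψ x)
    {Kf : Subgroup (finAdelic (↥(maximalRealSubfield L)) L (IsCMField.complexConj L) 3 H)}
    (hkf : ∀ k ∈ Kf, ∀ x, Ψ (x * finAdelicToAdelic (↥(maximalRealSubfield L)) L (IsCMField.complexConj L) 3 H k) = Ψ x)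
    (y x : (adelicGroupData (↥(maximalRealSubfield L)) L (IsCMField.complexConj L) 3 H).Adelic)
    (hx : finPart (↥(maximalRealSubfield L)) L (IsCMField.complexConj L) 3 H (y⁻¹ * x) ∈ Kf) :
    Ψ x = Ψ (y * cmArchSection L ι H T hT
      (archProjU21EmbCM L H ι T (formCongr_eq_of_conjTranspose L ι H T hT)
        (archPart (↥(maximalRealSubfield L)) L (IsCMField.complexConj L) 3 H (y⁻¹ * x)))) := by
  obtain ⟨k, hk, hdec⟩ := exists_eq_cmArchSection_mul_cmCompactFactor_mul_finAdelicToAdelic L ι H T hT (y⁻¹ * x)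
  have hx' : x = y * (y⁻¹ * x) := (mul_inv_cancel_left y x).symm
  conv_lhs => rw [hx', hdec, ← mul_assoc, ← mul_assoc]
  rw [hkf _ hx, hkc k hk]

/-- **Invariant sets are open**: a subset of `U(H)(𝔸_{L⁺})` that is right-invariant under `ιinf(U(2,1))`, under `K_c` and under `(1, K_f)`
for an OPEN `K_f` is open — it is a union of right cosets of the open subgroup `ιinf(U(2,1)) · K_c · (1, K_f) = U(H)(L⁺ ⊗ ℝ) × K_f`.  (Used
for the «bad set» of an orbital representative: open and `μ`-null on the quotient, hence empty.) [cite: BorelJacquet1979, §4.1]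
[cite: PlatonovRapinchuk1994, §5.1] -/
theorem isOpen_of_invariant
    {S : Set (adelicGroupData (↥(maximalRealSubfield L)) L (IsCMField.complexConj L) 3 H).Adelic}
    (harch : ∀ (g : U21) (x), x * cmArchSection L ι H T hT g ∈ S ↔ x ∈ S)
    (hkc : ∀ k ∈ cmCompactFactor L ι H T hT, ∀ x, x * k ∈ S ↔ x ∈ S)
    {Kf : Subgroup (finAdelic (↥(maximalRealSubfield L)) L (IsCMField.complexConj L) 3 H)}
    (hopen : IsOpen (Kf : Set (finAdelic (↥(maximalRealSubfield L)) L (IsCMField.complexConj L) 3 H)))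
    (hkf : ∀ k ∈ Kf, ∀ x, x * finAdelicToAdelic (↥(maximalRealSubfield L)) L (IsCMField.complexConj L) 3 H k ∈ S ↔ x ∈ S) :
    IsOpen S := by
  rw [isOpen_iff_forall_mem_open]
  intro y hy
  refine ⟨{x | finPart (↥(maximalRealSubfield L)) L (IsCMField.complexConj L) 3 H (y⁻¹ * x) ∈ Kf}, fun x hx => ?_,
    hopen.preimage ((continuous_finPart (↥(maximalRealSubfield L)) L (IsCMField.complexConj L) 3 H).comp
      (continuous_const.mul continuous_id)), ?_⟩
  · obtain ⟨k, hk, hdec⟩ := exists_eq_cmArchSection_mul_cmCompactFactor_mul_finAdelicToAdelic L ι H T hT (y⁻¹ * x)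
    have hx' : x = y * (y⁻¹ * x) := (mul_inv_cancel_left y x).symm
    rw [hx', hdec, ← mul_assoc, ← mul_assoc, hkf _ hx, hkc k hk, harch]
    exact hy
  · show finPart (↥(maximalRealSubfield L)) L (IsCMField.complexConj L) 3 H (y⁻¹ * y) ∈ Kf
    rw [inv_mul_cancel, map_one]
    exact one_mem Kf

/-- **(h4) GLOBAL CONTINUITY FROM ORBIT CONTINUITY AND INVARIANCE.**  Let `Ψ` be a function on `U(H)(𝔸_{L⁺})` (values in any
topological space) that is right-invariant under the compact archimedean factor `K_c = cmCompactFactor` and under `(1, K_f)` for an OPEN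
subgroup `K_f ≤ U(H)(𝔸_{L⁺,f})`, and whose orbit maps `g ↦ Ψ (y · ιinf g)` along the CM archimedean section `ιinf = cmArchSection` are
continuous on `U(2,1)` for every base point `y`.  Then `Ψ` is continuous: near `y` (on the open set `{x | (y⁻¹ x)_f ∈ K_f}`) it is the
composite of the orbit map at `y` with the continuous `U(2,1)`-coordinate `x ↦ pr_ι ((y⁻¹ x)_∞)`. [cite: BorelJacquet1979, §4.1]
[cite: PlatonovRapinchuk1994, §5.1] -/
theorem continuous_of_continuous_orbit_of_invariant {X : Type*} [TopologicalSpace X]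
    {Ψ : (adelicGroupData (↥(maximalRealSubfield L)) L (IsCMField.complexConj L) 3 H).Adelic → X}
    (horb : ∀ y, Continuous fun g : U21 => Ψ (y * cmArchSection L ι H T hT g))
    (hkc : ∀ k ∈ cmCompactFactor L ι H T hT, ∀ x, Ψ (x * k) = Ψ x)
    {Kf : Subgroup (finAdelic (↥(maximalRealSubfield L)) L (IsCMField.complexConj L) 3 H)}
    (hopen : IsOpen (Kf : Set (finAdelic (↥(maximalRealSubfield L)) L (IsCMField.complexConj L) 3 H)))
    (hkf : ∀ k ∈ Kf, ∀ x, Ψ (x * finAdelicToAdelic (↥(maximalRealSubfield L)) L (IsCMField.complexConj L) 3 H k) = Ψ x) :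
    Continuous Ψ := by
  -- the continuous `U(2,1)`-coordinate relative to the base point `y`
  set πU : (adelicGroupData (↥(maximalRealSubfield L)) L (IsCMField.complexConj L) 3 H).Adelic →
      (adelicGroupData (↥(maximalRealSubfield L)) L (IsCMField.complexConj L) 3 H).Adelic → U21 :=
    fun y x => archProjU21EmbCM L H ι T (formCongr_eq_of_conjTranspose L ι H T hT)
      (archPart (↥(maximalRealSubfield L)) L (IsCMField.complexConj L) 3 H (y⁻¹ * x)) with hπU
  have hπc : ∀ y, Continuous (πU y) := fun y =>
    (continuous_archProjU21EmbCM L H ι T _).comp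
      ((continuous_archPart (↥(maximalRealSubfield L)) L (IsCMField.complexConj L) 3 H).comp
        (continuous_const.mul continuous_id))
  rw [continuous_iff_continuousAt]
  intro y
  -- the open slab `{x | (y⁻¹ x)_f ∈ K_f}` around `y`
  set V : Set (adelicGroupData (↥(maximalRealSubfield L)) L (IsCMField.complexConj L) 3 H).Adelic :=
    {x | finPart (↥(maximalRealSubfield L)) L (IsCMField.complexConj L) 3 H (y⁻¹ * x) ∈ Kf} with hV
  have hVopen : IsOpen V :=
    hopen.preimage ((continuous_finPart (↥(maximalRealSubfield L)) L (IsCMField.complexConj L) 3 H).comp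
      (continuous_const.mul continuous_id))
  have hyV : y ∈ V := by
    show finPart (↥(maximalRealSubfield L)) L (IsCMField.complexConj L) 3 H (y⁻¹ * y) ∈ Kf
    rw [inv_mul_cancel, map_one]
    exact one_mem Kf
  have hEq : Set.EqOn Ψ (fun x => Ψ (y * cmArchSection L ι H T hT (πU y x))) V := fun x hx =>
    apply_eq_apply_mul_cmArchSection L ι H T hT hkc hkf y x hx
  have hcontV : ContinuousOn Ψ V :=
    (((horb y).comp (hπc y)).continuousOn).congr hEq
  exact hcontV.continuousAt (hVopen.mem_nhds hyV)

/-- **(h4), scalar pair form for (R)**: the same for a pair `Ψ : Fin 2 → (U(H)(𝔸_{L⁺}) → ℂ)` with the invariances stated for both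
coordinates at once (the shape in which `stub_R_regularOfReproduced` receives `K_c`/`K_f`). [cite: BorelJacquet1979, §4.1] -/
theorem continuous_of_continuous_orbit_of_invariant_pair
    {Ψ : Fin 2 → ((adelicGroupData (↥(maximalRealSubfield L)) L (IsCMField.complexConj L) 3 H).Adelic → ℂ)}
    (horb : ∀ j y, Continuous fun g : U21 => Ψ j (y * cmArchSection L ι H T hT g))
    (hkc : ∀ k ∈ cmCompactFactor L ι H T hT, ∀ j x, Ψ j (x * k) = Ψ j x)
    (hkf : ∃ Kf : Subgroup (finAdelic (↥(maximalRealSubfield L)) L (IsCMField.complexConj L) 3 H),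
      IsOpen (Kf : Set (finAdelic (↥(maximalRealSubfield L)) L (IsCMField.complexConj L) 3 H)) ∧
        ∀ k ∈ Kf, ∀ j x, Ψ j (x * finAdelicToAdelic (↥(maximalRealSubfield L)) L (IsCMField.complexConj L) 3 H k) = Ψ j x)
    (j : Fin 2) : Continuous (Ψ j) := by
  obtain ⟨Kf, hopen, hKf⟩ := hkf
  exact continuous_of_continuous_orbit_of_invariant L ι H T hT (horb j) (fun k hk x => hkc k hk j x) hopen
    (fun k hk x => hKf k hk j x)

end Summit.HodgeConjecture.HodgeConjecture.Cruxes.H413.F0P2dArchOrbitContinuity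

end
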